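import Literature.Topology.FourManifolds.ComplexProjectiveSpacePositiveAtlas

/-!
# Two-chart bookkeeping of a continuous map `ℂℙ¹ → X`
(registered helper `helper_twoChartOfGlued` of line `cross-cap-laurent`, crux `GromovRecognitionRelEnd`,
item stmt-SmoothPoincare4-11009; it serves the birth stub `stub_uniformLimitIsJSphere` of the Gromov
compactness fact, child item stmt-SmoothPoincare4-16777: a uniform limit `F : C(ℂℙ¹, X)` of glued maps
of two-chart spheres is again the glued map of a two-chart sphere)

Setting: `X` a topological space, `F : C(ℂℙ¹, X)` a continuous map on the tree's
`Literature.Topology.FourManifolds.ComplexProjectiveSpace 1`, read in the two affine charts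
`affineChart 0` (`[v₀ : v₁] ↦ v₁ / v₀`, inverse `z ↦ [1 : z]`) and `affineChart 1`
(`[v₀ : v₁] ↦ v₀ / v₁`, inverse `w ↦ [w : 1]`), the model `ℝ²` being identified with `ℂ` through
`z ↦ realCoordinates 1 (fun _ => z)`.  Put `u z := F [1 : z]` and `v w := F [w : 1]`.

Claim (`helper_twoChartOfGlued`), pure `ℂℙ¹` bookkeeping (Griffiths–Harris, Ch. 0 §2):
(i) `v z = u z⁻¹` for `z ≠ 0`, because `[z : 1] = [1 : z⁻¹]`;
(ii) a point `p` of the chart `{v₀ ≠ 0}` is `[1 : affineCoordComplex 0 p 0]`, so `F p = u (…)`;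
(iii) a point `p` of the chart `{v₁ ≠ 0}` is `[affineCoordComplex 1 p 0 : 1]`, so `F p = v (…)`;
(iv), (v) `u` and `v` are continuous (composites of `F`, a chart inverse — continuous on the chart
target, which is the whole model space — and a continuous linear equivalence after the continuous
`z ↦ (fun _ => z)`).

Proof of (i): for `p = [z : 1] = (affineChart 1)⁻¹ z` the second affine coordinate is `z ≠ 0`
(`affineCoordComplex_affineChart_symm`), hence `p` lies in the chart `{v₀ ≠ 0}` (outside it the
second coordinate vanishes, `affineCoordComplex_one_eq_zero`), its first affine coordinate is
`z⁻¹` (`affineCoordComplex_one_eq_inv`: the second coordinate is the inverse of the first), and a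
point of the chart `{v₀ ≠ 0}` is the inverse chart of its first coordinate
(`affineChart_symm_affineCoordComplex`).  (ii), (iii) are `affineChart_symm_affineCoordComplex`.

References: P. Griffiths, J. Harris, *Principles of Algebraic Geometry* (1978), Ch. 0 §2 (the two
charts of the Riemann sphere).  No new definitions, notation or instances.
-/

open Set Function
open Literature.Topology.FourManifolds Literature.Topology.FourManifolds.ComplexProjectiveSpace

-- the prescribed namespace `Summit.<P>.<Sub>.…` duplicates `SmoothPoincare4` (P = Sub)
set_option linter.dupNamespace false

namespace Summit.SmoothPoincare4.SmoothPoincare4.Theorems.GromovRecognitionRelEnd.CrossCapLaurent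

namespace TwoChartOfGlued

/-- On `ℂℙ¹`, `[z : 1] = [1 : z⁻¹]` for `z ≠ 0`: the inverse second chart at `z` is the inverse
first chart at `z⁻¹`. [cite: GriffithsHarrisPrinciples1978, Ch. 0 §2] -/
theorem affineChart_one_symm_eq_affineChart_zero_symm_inv {z : ℂ} (hz : z ≠ 0) :
    (affineChart (n := 1) 1).symm (realCoordinates 1 fun _ : Fin 1 => z) =
      (affineChart (n := 1) 0).symm (realCoordinates 1 fun _ : Fin 1 => z⁻¹) := by
  set p := (affineChart (n := 1) 1).symm (realCoordinates 1 fun _ : Fin 1 => z) with hp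
  -- the second affine coordinate of `p = [z : 1]` is `z`
  have h1 : affineCoordComplex 1 p 0 = z := affineCoordComplex_affineChart_symm 1 z
  -- hence `p` lies in the chart `{v₀ ≠ 0}`
  have h0 : CoordNeZero 0 p := by
    by_contra h
    exact hz (h1.symm.trans (affineCoordComplex_one_eq_zero h))
  -- and its first affine coordinate is `z⁻¹`
  have h2 : affineCoordComplex 0 p 0 = z⁻¹ := by
    rw [← h1, affineCoordComplex_one_eq_inv p, inv_inv]
  rw [← h2]
  exact (affineChart_symm_affineCoordComplex h0).symm

/-- The inverse affine charts `z ↦ (affineChart i)⁻¹ z` of `ℂℙ¹`, read through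
`z ↦ realCoordinates 1 (fun _ => z)`, are continuous maps `ℂ → ℂℙ¹`. [folklore] -/
theorem continuous_affineChart_symm_realCoordinates (i : Fin (1 + 1)) :
    Continuous fun z : ℂ => (affineChart (n := 1) i).symm (realCoordinates 1 fun _ : Fin 1 => z) :=
  (affineChart (n := 1) i).continuousOn_symm.comp_continuous
    ((realCoordinates 1).continuous.comp (continuous_pi fun _ => continuous_id))
    fun _ => mem_univ _

end TwoChartOfGlued

open TwoChartOfGlued

/-- **Two-chart bookkeeping of a continuous map `F : ℂℙ¹ → X`** (Griffiths–Harris, Ch. 0 §2).  With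
`u z := F [1 : z]` and `v w := F [w : 1]`: (i) `v z = u z⁻¹` off `0`; (ii) on the chart `{v₀ ≠ 0}`,
`F p = u (affineCoordComplex 0 p 0)`; (iii) on the chart `{v₁ ≠ 0}`, `F p = v (affineCoordComplex 1 p 0)`;
(iv), (v) `u` and `v` are continuous. [cite: GriffithsHarrisPrinciples1978, Ch. 0 §2] -/
theorem helper_twoChartOfGlued : ∀ (X : Type) [TopologicalSpace X] (F : C(Literature.Topology.FourManifolds.ComplexProjectiveSpace 1, X)), (∀ z : ℂ, z ≠ 0 → F ((Literature.Topology.FourManifolds.ComplexProjectiveSpace.affineChart (n := 1) 1).symm (Literature.Topology.FourManifolds.ComplexProjectiveSpace.realCoordinates 1 fun _ => z)) = F ((Literature.Topology.FourManifolds.ComplexProjectiveSpace.affineChart (n := 1) 0).symm (Literature.Topology.FourManifolds.ComplexProjectiveSpace.realCoordinates 1 fun _ => z⁻¹))) ∧ (∀ p, Literature.Topology.FourManifolds.ComplexProjectiveSpace.CoordNeZero 0 p → F p = F ((Literature.Topology.FourManifolds.ComplexProjectiveSpace.affineChart (n := 1) 0).symm (Literature.Topology.FourManifolds.ComplexProjectiveSpace.realCoordinates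 1 fun _ => Literature.Topology.FourManifolds.ComplexProjectiveSpace.affineCoordComplex 0 p 0))) ∧ (∀ p, Literature.Topology.FourManifolds.ComplexProjectiveSpace.CoordNeZero 1 p → F p = F ((Literature.Topology.FourManifolds.ComplexProjectiveSpace.affineChart (n := 1) 1).symm (Literature.Topology.FourManifolds.ComplexProjectiveSpace.realCoordinates 1 fun _ => Literature.Topology.FourManifolds.ComplexProjectiveSpace.affineCoordComplex 1 p 0))) ∧ Continuous (fun z : ℂ => F ((Literature.Topology.FourManifolds.ComplexProjectiveSpace.affineChart (n := 1) 0).symm (Literature.Topology.FourManifolds.ComplexProjectiveSpace.realCoordinates 1 fun _ => z))) ∧ Continuous (fun w : ℂ => F ((Literature.Topology.FourManifolds.ComplexProjectiveSpace.affineChart (n := 1) 1).symm (Literature.Topology.FourManifolds.ComplexProjectiveSpace.realCoordinates 1 fun _ => w))) := by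
  intro X _ F
  refine ⟨fun z hz => ?_, fun p hp => ?_, fun p hp => ?_,
    F.continuous.comp (continuous_affineChart_symm_realCoordinates 0),
    F.continuous.comp (continuous_affineChart_symm_realCoordinates 1)⟩
  · rw [affineChart_one_symm_eq_affineChart_zero_symm_inv hz]
  · rw [affineChart_symm_affineCoordComplex hp]
  · rw [affineChart_symm_affineCoordComplex hp]

end Summit.SmoothPoincare4.SmoothPoincare4.Theorems.GromovRecognitionRelEnd.CrossCapLaurent
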